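import Mathlib
import Literature.Analysis.FluidPDE.SelfSimilarEulerProfile
import Summits.NavierStokesRegularity.NavierStokesRegularity.Theorems.EulerZoomLiouvillePowerGaugeEulerLiouvilleHoopDefs

/-!
# Hoop line — the K-TJ″ face `HasStraightSlowHighRunsFree ρ V` (alt 8′) and the end-disc objects `discMass`, `discEnergy` (definitions only)

Sub-problem `NavierStokesRegularity`, crux `PowerGaugeEulerLiouville` (stmt-NavierStokesRegularity-19832; a crux CLASS, not NS regularity); LEAD ns-typeII-p2 g15.
Texts VERBATIM from nsreg-p2 g40 ROUND-50 (`r50/TJfree_Q.lean` sha16 638bc7e3324a10ed l.50–66: the face; `r50/Sketch50.lean` 6c31f8f6e879902e: `discMass`) and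
nsreg-p2 g41 ROUND-51 (`r51/Sketch51.lean` 3a26356e4f98d965 l.80–83: `discEnergy`).  Landed as definitions so that the member theorem (ns-ezl-w3 g7
`Loc.selfSimilar_ae_eq_zero_of_straightSlowHighRunsFreeC2_profile`, built), the NET axis pressure-drop law (`AxisPressureDropLaw γ`), the cap bounds (t54-CAP/CC) and the
LEAD skeleton (`IsKinematicTameProfile ρ c V` alternative 9) all reference them BY NAME.

Relative to alt 8 `HasStraightSlowHighRuns ρ c V` (`…HoopRunDefs`, p692587) three clauses are gone: the wall-speed clause (paid by `HoopCore.lateralHoopInequality`), the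
budget constant `c` (E-TAIL `Condenser.energyTail`), the interior-speed clause (every remaining cost lives on the two end discs); the constraint is
`4K² + 4K < Λ·(½γ(1−γ) − ½λ² − η)`, `γ = 1/(2+ρ)`.  Nothing is proved here; 19832 OPEN; NS regularity NOT proved.
-/

noncomputable section

set_option linter.dupNamespace false

open Set Metric MeasureTheory Function
open scoped RealInnerProductSpace ENNReal NNReal

namespace Summit.NavierStokesRegularity.NavierStokesRegularity.Theorems.PowerGaugeEulerLiouville

open Literature.Analysis Literature.Analysis.FluidPDE

/-- **K-TJ″ FACE (alt 8′)** «arbitrarily far out there is a straight, thin-walled (ambient circle-mean PRESSURE at radius `b = R^{−(1+ρ)}`),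
slow ∧ Bernoulli-high run of length `≥ Λ·b` whose two END DISCS carry speed `≤ K R`», with the ONE constraint
`4K² + 4K < Λ·(½γ(1−γ) − ½λ² − η)`, `γ = 1/(2+ρ)` — no budget constant, no wall-speed clause, no interior-speed clause.
Run = image under the rigid motion `x ↦ A x + a` of `HoopCore.solidCyl s₁ s₂ b`. [nsreg-p2 g40 ROUND-50 §1/§3, r50/TJfree_Q.lean VERBATIM; ns-idea-11 HOOP-NOTE §10(a)] -/
def HasStraightSlowHighRunsFree (ρ : ℝ)
    (V : EuclideanSpace ℝ (Fin 3) → EuclideanSpace ℝ (Fin 3)) : Prop :=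
  ∀ P' : EuclideanSpace ℝ (Fin 3) → ℝ, IsSelfSimilarEulerProfile (1 / (2 + ρ)) 0 V P' →
    ∃ Λ lam η K : ℝ, 0 < Λ ∧ 0 ≤ lam ∧ 0 ≤ η ∧ 0 ≤ K ∧
      4 * K ^ 2 + 4 * K < Λ * ((1 / (2 + ρ)) * (1 - 1 / (2 + ρ)) / 2 - lam ^ 2 / 2 - η) ∧
      ∀ R₀ : ℝ, ∃ (A : EuclideanSpace ℝ (Fin 3) ≃ₗᵢ[ℝ] EuclideanSpace ℝ (Fin 3)) (a : EuclideanSpace ℝ (Fin 3))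
          (R s₁ s₂ h : ℝ),
        R₀ ≤ R ∧ 1 ≤ R ∧ s₁ + Λ * R ^ (-(1 + ρ)) ≤ s₂ ∧
        (∀ x ∈ HoopCore.solidCyl s₁ s₂ (R ^ (-(1 + ρ))),
            R ≤ ‖A x + a‖ ∧ ‖A x + a‖ ≤ 2 * R ∧ ((x 2 = s₁ ∨ x 2 = s₂) → ‖V (A x + a)‖ ≤ K * R)) ∧
        (∀ σ ∈ Icc s₁ s₂,
            ‖selfSimilarTransport (1 / (2 + ρ)) 0 V (A (σ • eZ) + a)‖ ≤ lam * R ∧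
            h ≤ selfSimilarBernoulli (1 / (2 + ρ)) 0 V P' (A (σ • eZ) + a) ∧
            HoopCore.circleAvg (fun x => P' (A x + a)) σ (R ^ (-(1 + ρ))) ≤ h + η * R ^ 2)

namespace HoopCore

/-- Disc mass `discMass V σ T = ∫₀^T t·⟨V_z⟩_θ(σ,t) dt` (`2π·discMass` = axial volume flux through the disc `{y₂ = σ, r ≤ T}`; the tree's
`HoopCore.sliceMassIdentity` (p690507) reads `T₀ · ⟨V_r⟩_θ(σ,T₀) = −∂_σ discMass V σ T₀`). [nsreg-p2 ROUND-50 `discMass`, r50/Sketch50.lean VERBATIM] -/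
def discMass (V : EuclideanSpace ℝ (Fin 3) → EuclideanSpace ℝ (Fin 3)) (σ T : ℝ) : ℝ :=
  ∫ t in (0 : ℝ)..T, t * circleAvg (axialVelocity V) σ t

/-- DISC ENERGY at height `σ`, radius `T₀`: `∫_{‖z‖ ≤ T₀} |DV(liftAt σ z)|_F² dz` (`= ∫₀^{2π}∫₀^{T₀} t·|DV(axisPt σ t θ)|_F² dt dθ`;
Fubini: `∫_a^{a+ℓ} discEnergy V σ T₀ dσ = ∫_{solidCyl a (a+ℓ) T₀} |DV|_F²`). [nsreg-p2 ROUND-51 `discEnergy`, r51/Sketch51.lean VERBATIM] -/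
def discEnergy (V : EuclideanSpace ℝ (Fin 3) → EuclideanSpace ℝ (Fin 3)) (σ T₀ : ℝ) : ℝ :=
  ∫ z in closedBall (0 : EuclideanSpace ℝ (Fin 2)) T₀, frobeniusNormSq (fderiv ℝ V (liftAt σ z))

end HoopCore

end Summit.NavierStokesRegularity.NavierStokesRegularity.Theorems.PowerGaugeEulerLiouville

end
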